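import Literature.Computability.QuantumComplexity.OracleCoinState
import Literature.Computability.QuantumComplexity.OracleCoinUniform
import HarnessLib

/-!
# Discharge of `uniformOracleCoinSimulation`

Topic `Literature/Computability/QuantumComplexity`; proof companion of `CoinFamilyKernel.lean`.
**`uniformOracleCoinSimulation_holds`**: for `G ∈ FP^A` (a polynomial-time oracle algorithm `M`
with round/query-length polynomial `r`, `Oracle.lean`) and a coin polynomial `q`, the coin family
`OCoin.family` of `OracleCoinLayout.lean` — Hadamard on the coin wires, then the compiled classical
part with oracle gates (answer slots, one garbage-free block replaying `M` against the slots, query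
windows, `R + 1` oracle queries per round, output swapped to the front) — is polynomial-time
uniform (`OCoin.family_isUniform`, `OracleCoinUniform.lean`), maps `|x⟩|y⟩|0…0⟩` relative to
`A` to the basis state `|OCoin.out x y A⟩` injectively in the coins, and the genuine output
`G ⟨x, y⟩` is a prefix of the read-out (`OCoin.out_prefix`, `OCoin.out_injective`,
`OracleCoinState.lean`; the run data from the `FPRel` clauses by `OSim.exists_runShape`, the block
machine by `RevClean.exists_outputsWithin_pow_of_mem_FP` and `OCoin.simFn_mem_FP`). This is the
relativised classical core of Bernstein–Vazirani's `BPP ⊆ BQP` (Thm. 8.3, with the oracle track of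
§8.3) in the tree's circuit model.

## References

* E. Bernstein, U. Vazirani, *Quantum complexity theory*, SIAM J. Comput. 26 (1997) 1411–1473,
  Thm. 8.3 (proof, p. 1451) and §8.3 (p. 1455, oracle QTMs) [BernsteinVazirani1997SICOMP].
* C. H. Bennett, E. Bernstein, G. Brassard, U. Vazirani, *Strengths and weaknesses of quantum
  computing*, SIAM J. Comput. 26 (1997) 1510–1523, §2 (arXiv:quant-ph/9701001, p. 4)
  [BennettBernsteinBrassardVazirani1997].
* S. Arora, B. Barak, *Computational Complexity: A Modern Approach*, CUP 2009, Lemma 10.10,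
  Thm. 6.6 / Remark 6.7 [AroraBarak2009].
-/

noncomputable section

namespace Literature.Computability.QuantumComplexity

open _root_.Computability Complexity Cryptography RevClean

/-- **Uniform reversible simulation of polynomial-time oracle computations on coins**
(Bernstein–Vazirani 1997, proof of Thm. 8.3 relativised as in §8.3): the named fact
`uniformOracleCoinSimulation` holds. [cite: BernsteinVazirani1997SICOMP, Thm. 8.3 (proof) and §8.3 (oracle quantum Turing machines)] -/
theorem uniformOracleCoinSimulation_holds : uniformOracleCoinSimulation := by
  intro A G q hG
  obtain ⟨M, hM, r, hr⟩ := hG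
  obtain ⟨e, Mtm, hMtm⟩ := exists_outputsWithin_pow_of_mem_FP (OCoin.simFn_mem_FP (M := M) (r := r) (q := q) hM)
  let P : OCoin.Params := ⟨q, r, M, e, Mtm, hMtm⟩
  refine ⟨OCoin.mW P, OCoin.Dc P, fun n x y => OCoin.out P x y A, OCoin.family_isUniform P,
    fun n x y => OCoin.Dc_mulVec_coinInput P x y A, fun n x => OCoin.out_injective P x A, fun n x y => ?_⟩
  have hxy := hr (OCoin.xin P x y)
  rw [OCoin.RR_eq P x y] at hxy
  obtain ⟨m, hmR, hshape, hQ⟩ := OSim.exists_runShape hxy.1 hxy.2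
  exact OCoin.out_prefix P x y A hshape hmR hQ

end Literature.Computability.QuantumComplexity

end
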